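import Summits.AtomisticToContinuum.HydrodynamicLimit.Theorems.CollisionIsometryCLTCollisionalTransferLocalityStressLawFixedAOfEvenStress
import Summits.AtomisticToContinuum.HydrodynamicLimit.Theorems.CollisionIsometryCLTCollisionalTransferLocalityEnvelopeA
import Summits.AtomisticToContinuum.HydrodynamicLimit.Theorems.CollisionIsometryCLTCollisionalTransferLocalityGridReduction
import Summits.AtomisticToContinuum.HydrodynamicLimit.Theorems.CollisionIsometryCLTCollisionalTransferLocalityConeLLNConst
import HarnessLib

/-!
# The cone-scale FIXED-TIME momentum law from `EvenStressEnskog`, the cone-kernel value envelope and the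
# grid core (line `hemisphere-affine-slaving`, crux `CollisionalTransferLocality`, stmt-AtomisticToContinuum-9518)

Supporting file (`--supports stmt-AtomisticToContinuum-9518`) for the registered stub
`stub_collisionalStressLawCone_of_evenStress` (the `sup_τ` collisional STRESS law at the MACROSCOPIC radius `r`,
momentum half of the macroscale restatement of the crux, RoutePatchC11). It lands the three `r`-fixed inputs its
`sup_τ` assembly (file `…StressLawConeSup`) consumes:

* `stressLawConeFixedA_of_evenStress` (registered helper, top level) — THE CONE-SCALE FIXED-TIME LAW: `EvenStressEnskog` (13079, BY
  NAME) implies, for nice profiles, `σ < σ₀ := min σ₀^{13079} (1/2)`, dilute level `η₁ := η₀'/8`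
  (`η₀' := min η₀ η_B`, `η_B` the band of `DockA.exists_band_function`), every flow family, horizon `t > 0`,
  admissible mesoscale kernel family `φ` with the dilute event `DiluteAt … φ η₁`, every matrix weight `A` smooth
  on `[0, t]` and every FIXED `τ ∈ [0, t]`:
  `∀ η δ, ∃ r₀, ∀ r < r₀, ∃ N₀, ∀ N ≥ N₀, P_N{η < |M_N^A(τ) − (RhsA + KfunA)[b_r](A)(τ)|} ≤ δ`,
  `b_r := fun _ y => coneKernel r y 0` the fixed cone kernel. This is the proof of c10's dock
  `stub_stressLawFixedA_of_evenStressEnskog` (…StressLawFixedAOfEvenStress) WITHOUT its last two-scale step [TS]: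
  `τ = 0` is the empty event (`DockA.MfunA_zero`, `DockA.RhsA_add_KfunA_zero`); for `τ > 0` the radii come from
  nine instances of 13079 (clamped weights `A(projIcc s, x)_kl`, window cut-off `max 0 (min 1 (2 − 2a/η₀'))`,
  level `η/5`, probability `δ/11`), the particle numbers from those, from `DiluteAt` (probability `δ/11`) and
  from `(N+1)^{-γ} < min r (r/(c+1))` (`c` of [CeilR] `stub_mollDensity_le_of_blockCeiling`); off the null set
  "bad set ∪ contact sets" (`localGibbsLaw_compl_good'`, `ParityBandClosurePressureValue.localGibbsLaw_contactSet`)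
  the union bound `measure_le_of_imp3` (`DockA.two_add_nine`) reduces the claim to the deterministic core
  `DockA.core_bound` (called BY NAME): the block ceiling is an `r`-ceiling ([CeilR]), so the cut-off is inert and
  `|M_N^A(τ) − (RhsA + KfunA)[b_r](τ)| ≤ (9/2)(η/5) < η`.
* `ConeFixedA.envelopeA_cone` — the Lipschitz-in-time envelope of the cone-kernel value on a good orbit with an
  `r`-ceiling `ρ_r σ³ ≤ η₂ ≤ η_Z`: `|(RhsA + KfunA)[b_r](τ') − (RhsA + KfunA)[b_r](τ)| ≤ 60 C_A K η₂ (N+1)⁻¹E(z) (τ' − τ)`.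
  The cone family is NOT an admissible kernel family (fixed support radius), so [EnvA] `stub_envelopeA` does not
  apply verbatim; but its engine `EnvelopeA.lipschitz_of_continuous` only uses continuity
  (`ConeLLNConst.continuous_coneKernel_zero`), nonnegativity (`coneKernel_nonneg'`) and mass one
  (`integral_coneKernel`, `r < 1/2`) of the kernel, after clamping `A` in time through `projIcc 0 t`.
* `ConeFixedA.sup_le_of_grid` — the deterministic grid core of the `sup_τ` step (pure real analysis): monotone
  domination of the increments of `J` by `V`, Lipschitz values `R, R₁`, and grid bounds `|J − R|, |V − R₁| ≤ d` at the
  `n + 1` times `kt/n` give `sup_{τ ≤ t} |J(τ) − R(τ)| ≤ d + C(2d + L₁ t/n) + L_ψ t/n`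
  (`exists_grid_index_of_dominated_increments`).
No new definitions, no named facts; axioms `propext`, `Classical.choice`, `Quot.sound`. Background: Chapman–Cowling
(1970) §16.4; van Beijeren–Ernst, Physica 68 (1973) 437.
-/

namespace Summit.AtomisticToContinuum.HydrodynamicLimit.Theorems.HemisphereAffineSlaving

open scoped BigOperators Topology Classical ENNReal InnerProductSpace
open Filter Set Function MeasureTheory

noncomputable section

open Literature.MathematicalPhysics.KineticTheory (T3 V3)
open Literature.Analysis.FunctionSpaces

namespace ConeFixedA

open Literature.MathematicalPhysics.KineticTheory (coneKernel hsCompressibility integral_coneKernel)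
open Literature.Analysis.FluidPDE (configEnergy)

/-! ## The Lipschitz envelope of the cone-kernel value -/

/-- **The value envelope on cone-kernel block fields.** For `σ > 0`, `K ≥ 0`, `η₂ ≤ η_Z` with
`|Z(η) − 1| ≤ Kη` on `[0, η_Z]`, `0 < r < 1/2`, a good initial datum, `t > 0`, a matrix weight `A` smooth on
`[0, t]` with `|A_ab| ≤ C_A` there, and an `r`-CEILING `ρ̄[b_r] σ³ ≤ η₂` along the orbit on `[0, t]`: for
`0 ≤ τ ≤ τ' ≤ t`, `|(RhsA + KfunA)[b_r](τ') − (RhsA + KfunA)[b_r](τ)| ≤ 60 C_A K η₂ (N+1)⁻¹ E(z) (τ' − τ)`.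
(`EnvelopeA.lipschitz_of_continuous` for the continuous, nonnegative, mass-one kernel `coneKernel r · 0`, after
clamping `A` in time through `projIcc 0 t`; the values for `τ ≤ t` only read `A` on `[0, t]`.) [folklore] -/
theorem envelopeA_cone {σ K ηZ η₂ CA r t : ℝ} (hσ : 0 < σ) (hK : 0 ≤ K) (hη₂Z : η₂ ≤ ηZ)
    (hZ : ∀ η : ℝ, 0 ≤ η → η ≤ ηZ → |hsCompressibility η - 1| ≤ K * η) (hr : 0 < r) (hr2 : r < 1 / 2)
    (Φ : Flows σ) {N : ℕ} {z : Cfg N} (hz : z ∈ (Φ N).good) (ht : 0 < t)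
    {A : ℝ → T3 → Fin 3 → Fin 3 → ℝ} (hA : SmoothMatrixOn (Icc 0 t) A)
    (hAb : ∀ s ∈ Icc 0 t, ∀ (x : T3) (a b : Fin 3), |A s x a b| ≤ CA)
    (hdil : ∀ s ∈ Icc 0 t, ∀ x : T3,
      rhoB (fun (_ : ℕ) (y : T3) => coneKernel r y 0) N ((Φ N).flow s z) x * σ ^ 3 ≤ η₂)
    {τ τ' : ℝ} (hτ : 0 ≤ τ) (hττ' : τ ≤ τ') (hτ't : τ' ≤ t) :
    |RhsA σ Φ (fun (_ : ℕ) (y : T3) => coneKernel r y 0) A N z τ' +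
        KfunA σ Φ (fun (_ : ℕ) (y : T3) => coneKernel r y 0) A N z τ' -
      (RhsA σ Φ (fun (_ : ℕ) (y : T3) => coneKernel r y 0) A N z τ +
        KfunA σ Φ (fun (_ : ℕ) (y : T3) => coneKernel r y 0) A N z τ)| ≤
      60 * CA * K * η₂ * (((N : ℝ) + 1)⁻¹ * configEnergy z) * (τ' - τ) := by
  -- adapted from the proof of `stub_envelopeA` (…EnvelopeA): clamp the weight in time, then the engine
  set b : ℕ → T3 → ℝ := fun (_ : ℕ) (y : T3) => coneKernel r y 0 with hb_def
  have hφc : Continuous (b N) := ConeLLNConst.continuous_coneKernel_zero r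
  have hφ0 : ∀ y, 0 ≤ b N y := fun y => ParityBandClosurePressureValue.coneKernel_nonneg' hr y 0
  have hφ1 : ∫ y, b N y = 1 := integral_coneKernel hr hr2 0
  set Ac : ℝ → T3 → Fin 3 → Fin 3 → ℝ := fun s x => A (projIcc 0 t ht.le s) x with hAc_def
  have hAcc : ∀ a b, Continuous fun q : ℝ × T3 => Ac q.1 q.2 a b := fun a b =>
    continuous_comp_projIcc ht (hA a b)
  have hCA : 0 ≤ CA := (abs_nonneg _).trans (hAb 0 ⟨le_rfl, ht.le⟩ 0 0 0)
  have hAcb : ∀ s x a b, |Ac s x a b| ≤ CA := fun s x a b => hAb _ (projIcc 0 t ht.le s).2 x a b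
  have htr : ∀ {s}, s ∈ Icc 0 t → ∀ x, trW Ac s x = trW A s x := fun hs x => by
    simp only [trW, hAc_def, projIcc_of_mem ht.le hs]
  have hkin : ∀ {s}, s ∈ Icc 0 t → ∀ (w : Cfg N) (x : T3), kinWA Ac b N s w x = kinWA A b N s w x :=
    fun hs w x => by simp only [kinWA, hAc_def, projIcc_of_mem ht.le hs]
  have hR : ∀ {u}, u ≤ t → RhsA σ Φ b Ac N z u = RhsA σ Φ b A N z u := fun hut => by
    unfold RhsA
    refine setIntegral_congr_fun measurableSet_Icc fun s hs => ?_
    simp only [htr ⟨hs.1, hs.2.trans hut⟩]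
  have hKq : ∀ {u}, u ≤ t → KfunA σ Φ b Ac N z u = KfunA σ Φ b A N z u := fun hut => by
    unfold KfunA
    refine setIntegral_congr_fun measurableSet_Icc fun s hs => ?_
    simp only [hkin ⟨hs.1, hs.2.trans hut⟩]
  have hcore := EnvelopeA.lipschitz_of_continuous hσ hK hη₂Z hZ Φ hφc hφ0 hφ1 hz hAcc hAcb hdil hτ hττ' hτ't
  rw [hR hτ't, hR (hττ'.trans hτ't), hKq hτ't, hKq (hττ'.trans hτ't), Nat.cast_succ] at hcore
  calc _ = |(RhsA σ Φ b A N z τ' - RhsA σ Φ b A N z τ) + (KfunA σ Φ b A N z τ' - KfunA σ Φ b A N z τ)| := by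
        ring_nf
    _ ≤ |RhsA σ Φ b A N z τ' - RhsA σ Φ b A N z τ| + |KfunA σ Φ b A N z τ' - KfunA σ Φ b A N z τ| :=
        abs_add_le _ _
    _ ≤ _ := hcore

/-! ## The deterministic grid core of the `sup_τ` step -/

/-- **Grid core.** If `V` is monotone on `[0, t]` and dominates the increments of `J` with constant `C ≥ 0`, `R` and
`R₁` are `L_ψ`- and `L₁`-Lipschitz on `[0, t]` (`L_ψ ≥ 0`), and at the `n + 1` grid times `kt/n` (`n > 0`) both
`|J − R| ≤ d` and `|V − R₁| ≤ d`, then `|J(τ) − R(τ)| ≤ d + C(2d + L₁ t/n) + L_ψ t/n` for every `τ ∈ [0, t]`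
(`exists_grid_index_of_dominated_increments` with the modulus `L_ψ t/n` of `R`, and the window increment
`V(τ_{k+1}) − V(τ_k) ≤ 2d + L₁ t/n` through `R₁` at the two ends of the cell). [folklore] -/
theorem sup_le_of_grid {t C L₁ Lψ d : ℝ} {n : ℕ} (ht : 0 < t) (hn : 0 < n) (hC : 0 ≤ C) (hLψ : 0 ≤ Lψ)
    (J V R R₁ : ℝ → ℝ) (hV : MonotoneOn V (Icc 0 t))
    (hJ : ∀ τ τ' : ℝ, 0 ≤ τ → τ ≤ τ' → τ' ≤ t → |J τ' - J τ| ≤ C * (V τ' - V τ))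
    (hR : ∀ τ τ' : ℝ, 0 ≤ τ → τ ≤ τ' → τ' ≤ t → |R τ' - R τ| ≤ Lψ * (τ' - τ))
    (hR₁ : ∀ τ τ' : ℝ, 0 ≤ τ → τ ≤ τ' → τ' ≤ t → |R₁ τ' - R₁ τ| ≤ L₁ * (τ' - τ))
    (hgJ : ∀ k : ℕ, k < n + 1 → |J (k * (t / n)) - R (k * (t / n))| ≤ d)
    (hgV : ∀ k : ℕ, k < n + 1 → |V (k * (t / n)) - R₁ (k * (t / n))| ≤ d) :
    ∀ τ ∈ Icc 0 t, |J τ - R τ| ≤ d + C * (2 * d + L₁ * (t / n)) + Lψ * (t / n) := by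
  intro τ hτ
  have hn' : (0 : ℝ) < n := Nat.cast_pos.2 hn
  have hh : 0 < t / n := div_pos ht hn'
  -- the Lipschitz bound of `R` is a two-sided modulus `L_ψ t/n` at scale `t/n`
  have hmod : ∀ a ∈ Icc 0 t, ∀ b ∈ Icc 0 t, |b - a| ≤ t / n → |R b - R a| ≤ Lψ * (t / n) := by
    intro a ha b hb hab
    rcases le_total a b with hab' | hba
    · refine (hR a b ha.1 hab' hb.2).trans (mul_le_mul_of_nonneg_left ?_ hLψ)
      rwa [abs_of_nonneg (sub_nonneg.2 hab')] at hab
    · rw [abs_sub_comm]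
      refine (hR b a hb.1 hba ha.2).trans (mul_le_mul_of_nonneg_left ?_ hLψ)
      rwa [abs_sub_comm, abs_of_nonneg (sub_nonneg.2 hba)] at hab
  obtain ⟨k, hk, hle⟩ := exists_grid_index_of_dominated_increments ht hn hC J V R hV hJ hmod τ hτ
  have h1 := hgJ k (by omega)
  have h2 := hgV k (by omega)
  have h3 := hgV (k + 1) (by omega)
  push_cast at h3
  -- the cell `[τ_k, τ_{k+1}] ⊆ [0, t]` and the increment of `V` over it through `R₁`
  have hk0 : 0 ≤ (k : ℝ) * (t / n) := mul_nonneg k.cast_nonneg hh.le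
  have hkk : (k : ℝ) * (t / n) ≤ ((k : ℝ) + 1) * (t / n) := mul_le_mul_of_nonneg_right (by linarith) hh.le
  have hk1n : (k : ℝ) + 1 ≤ n := by exact_mod_cast Nat.succ_le_of_lt hk
  have hk1t : ((k : ℝ) + 1) * (t / n) ≤ t := by
    calc ((k : ℝ) + 1) * (t / n) ≤ n * (t / n) := mul_le_mul_of_nonneg_right hk1n hh.le
      _ = t := mul_div_cancel₀ t hn'.ne'
  have h4 := hR₁ _ _ hk0 hkk hk1t
  rw [show ((k : ℝ) + 1) * (t / n) - k * (t / n) = t / n by ring] at h4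
  have hVinc : V (((k : ℝ) + 1) * (t / n)) - V (k * (t / n)) ≤ 2 * d + L₁ * (t / n) := by
    have e2 := (abs_le.mp h2).1
    have e3 := (abs_le.mp h3).2
    have e4 := (abs_le.mp h4).2
    linarith
  have hCV : C * (V (((k : ℝ) + 1) * (t / n)) - V (k * (t / n))) ≤ C * (2 * d + L₁ * (t / n)) :=
    mul_le_mul_of_nonneg_left hVinc hC
  linarith

end ConeFixedA

/-! ## The cone-scale fixed-time law from `EvenStressEnskog` -/

open Literature.MathematicalPhysics.KineticTheory (hsDiameter coneKernel mollDensity evenMark evenStat localGibbsLaw) in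
open Literature.Analysis.FluidPDE (contactSet) in
/-- **The cone-scale fixed-time momentum law from the sibling crux.** `EvenStressEnskog` (13079, by name) implies:
for nice profiles there are `σ₀ > 0` (`min σ₀^{13079} (1/2)`) and a dilute level `η₁ > 0` (`η₀'/8`) such that for
`0 < σ < σ₀`, every flow family, `t > 0`, every admissible mesoscale kernel family with the dilute event at level
`η₁`, every matrix weight `A` smooth on `[0, t]`, every fixed `τ ∈ [0, t]` and all `η, δ > 0` there is `r₀ > 0` with:
for `0 < r < r₀` eventually in `N`, `P_N{η < |M_N^A(τ) − (RhsA + KfunA)[b_r](A)(τ)|} ≤ δ` — the value read on the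
block fields of the FIXED cone kernel `b_r = coneKernel r · 0`. Proof: c10's dock without [TS] — empty event at
`τ = 0`; for `τ > 0` nine instances of 13079 (level `η/5`, probability `δ/11`), `DiluteAt`, `(N+1)^{-γ} ≪ r`,
union bound off the null set (bad set ∪ contact sets) through [CeilR] and `DockA.core_bound`. [folklore] -/
theorem stressLawConeFixedA_of_evenStress : Summit.AtomisticToContinuum.HydrodynamicLimit.Theses.JParityClosure.EvenStressEnskog → ∀ (a₀ θ₀ : T3 → ℝ) (u₀ : T3 → V3), NiceProfiles a₀ θ₀ u₀ → ∃ σ₀ : ℝ, 0 < σ₀ ∧ ∃ η₁ : ℝ, 0 < η₁ ∧ ∀ σ : ℝ, 0 < σ → σ < σ₀ → ∀ (Φ : Flows σ) (t : ℝ), 0 < t → ∀ (γ C : ℝ) (φ : ℕ → T3 → ℝ), 0 < γ → γ ≤ 1 / 15 → AdmissibleKernel γ C φ → DiluteAt σ a₀ θ₀ u₀ Φ t φ η₁ → ∀ (A : ℝ → T3 → Fin 3 → Fin 3 → ℝ), SmoothMatrixOn (Icc 0 t) A → ∀ τ ∈ Icc 0 t, ∀ η δ : ℝ, 0 < η → 0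 < δ → ∃ r₀ : ℝ, 0 < r₀ ∧ ∀ r : ℝ, 0 < r → r < r₀ → ∃ N₀ : ℕ, ∀ N : ℕ, N₀ ≤ N → Literature.MathematicalPhysics.KineticTheory.localGibbsLaw σ a₀ u₀ θ₀ N (Φ N) {z | η < |MfunA σ Φ A N z τ - (RhsA σ Φ (fun (_ : ℕ) (y : T3) => Literature.MathematicalPhysics.KineticTheory.coneKernel r y 0) A N z τ + KfunA σ Φ (fun (_ : ℕ) (y : T3) => Literature.MathematicalPhysics.KineticTheory.coneKernel r y 0) A N z τ)|} ≤ ENNReal.ofReal δ := by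
  -- adapted from the proof of `stub_stressLawFixedA_of_evenStressEnskog` (…StressLawFixedAOfEvenStress), [TS] removed
  intro h79 a₀ θ₀ u₀ hP
  obtain ⟨ha, hθ, hu, ha0, hθ0⟩ := hP
  obtain ⟨η₀, hη₀, H79⟩ := h79
  obtain ⟨σE, hσE, HE1⟩ := H79 a₀ θ₀ u₀ ha hθ hu ha0 hθ0
  obtain ⟨ηB, hηB, Yt, hYt, hYeq⟩ := DockA.exists_band_function
  obtain ⟨c, hc0, Hceil⟩ := stub_mollDensity_le_of_blockCeiling
  -- thresholds: cut-off radius `η₀' ≤ η₀, η_B`; dilute level `η₀'/8`; `σ₀ = min σ_E (1/2)`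
  set η₀' : ℝ := min η₀ ηB with hη₀'_def
  have hη₀' : 0 < η₀' := lt_min hη₀ hηB
  refine ⟨min σE (1 / 2), lt_min hσE (by norm_num), η₀' / 8, by positivity, ?_⟩
  intro σ hσ hlt Φ t ht γ C φ hγ _hγ' hadm hDil A hA τ hτ η δ hη hδ
  have hltE : σ < σE := lt_of_lt_of_le hlt (min_le_left _ _)
  have hhalf : σ ≤ 1 / 2 := (lt_of_lt_of_le hlt (min_le_right _ _)).le
  rcases hτ.1.eq_or_lt with h0 | hτpos
  · -- the instant `τ = 0`: the event is empty
    subst h0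
    refine ⟨1, one_pos, fun r _ _ => ⟨0, fun N _ => ?_⟩⟩
    have hE : {z : Cfg N | η < |MfunA σ Φ A N z 0 -
        (RhsA σ Φ (fun (_ : ℕ) (y : T3) => coneKernel r y 0) A N z 0 +
          KfunA σ Φ (fun (_ : ℕ) (y : T3) => coneKernel r y 0) A N z 0)|} = ∅ := by
      refine Set.eq_empty_iff_forall_notMem.2 fun z hz => ?_
      rw [mem_setOf_eq, DockA.MfunA_zero, DockA.RhsA_add_KfunA_zero, sub_zero, abs_zero] at hz
      exact lt_irrefl _ (hη.trans hz)
    rw [hE, measure_empty]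
    exact zero_le
  -- `0 < τ`
  set P : (N : ℕ) → Measure (Cfg N) := fun N => localGibbsLaw σ a₀ u₀ θ₀ N (Φ N) with hP_def
  have hη' : 0 < η / 5 := by positivity
  have hδ' : 0 < δ / 11 := by positivity
  -- the window cut-off and the clamped (jointly continuous) weights
  set g : ℝ → ℝ := fun a => max 0 (min 1 (2 - 2 * a / η₀')) with hg_def
  set a : Fin 3 → Fin 3 → ℝ × T3 → ℝ := fun k l p => A (projIcc 0 t ht.le p.1) p.2 k l with ha_def
  have hgc : Continuous g := by rw [hg_def]; fun_prop
  have hg0E : ∀ b, η₀ ≤ b → g b = 0 := fun b hb => DockA.cutoff_eq_zero hη₀' ((min_le_left _ _).trans hb)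
  have hac : ∀ k l, Continuous (a k l) := fun k l => continuous_comp_projIcc ht (hA k l)
  -- radii: nine instances of `EvenStressEnskog`
  have hE2 : ∀ p : Fin 3 × Fin 3, ∃ r₀ : ℝ, 0 < r₀ ∧ ∀ r : ℝ, 0 < r → r < r₀ → ∃ N₀ : ℕ, ∀ N : ℕ, N₀ ≤ N →
      ∀ k l : Fin 3, P N {z | η / 5 < |evenStat σ N (Φ N) τ (a p.1 p.2) g (evenMark k l) r z|} ≤
        ENNReal.ofReal (δ / 11) :=
    fun p => HE1 σ hσ hltE Φ τ hτpos (a p.1 p.2) (hac p.1 p.2) g hgc hg0E (η / 5) (δ / 11) hη' hδ'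
  choose rE hrE HE3 using hE2
  refine ⟨min (Finset.univ.inf' Finset.univ_nonempty rE) (1 / 8),
    lt_min ((Finset.lt_inf'_iff _).2 fun p _ => hrE p) (by norm_num), fun r hr hrlt => ?_⟩
  have hrE' : ∀ p, r < rE p := fun p =>
    hrlt.trans_le ((min_le_left _ _).trans (Finset.inf'_le _ (Finset.mem_univ p)))
  have hr4 : r < 1 / 4 := by linarith [hrlt.trans_le (min_le_right _ _)]
  -- particle numbers: 13079, the dilute event, the mesoscale against `r`
  choose NE HE5 using fun p => HE3 p r hr (hrE' p)
  obtain ⟨ND, HD⟩ := eventually_atTop.1 (((tendsto_order.1 hDil).2 _ (ENNReal.ofReal_pos.2 hδ')).mono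
    fun N h => h.le)
  have hρ0 : 0 < min r (r / (c + 1)) := lt_min hr (div_pos hr (by linarith))
  obtain ⟨Nγ, Hγ⟩ := eventually_atTop.1 (((tendsto_rpow_neg_atTop hγ).comp
    (tendsto_atTop_add_const_right atTop (1 : ℝ) tendsto_natCast_atTop_atTop)).eventually (gt_mem_nhds hρ0))
  refine ⟨max ND (max Nγ (Finset.univ.sup NE)), fun N hN => ?_⟩
  have hND : ND ≤ N := (le_max_left _ _).trans hN
  have hNE : ∀ p, NE p ≤ N := fun p =>
    (Finset.le_sup (Finset.mem_univ p)).trans (((le_max_right _ _).trans (le_max_right _ _)).trans hN)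
  have hℓ : ((N : ℝ) + 1) ^ (-γ) < min r (r / (c + 1)) :=
    Hγ N (((le_max_left _ _).trans (le_max_right _ _)).trans hN)
  have hℓr : ((N : ℝ) + 1) ^ (-γ) ≤ r := (hℓ.trans_le (min_le_left _ _)).le
  have hcℓ : c * ((N : ℝ) + 1) ^ (-γ) ≤ r := by
    have h1 := (lt_div_iff₀ (by linarith : (0 : ℝ) < c + 1)).1 (hℓ.trans_le (min_le_right _ _))
    have hℓ0 : 0 ≤ ((N : ℝ) + 1) ^ (-γ) := Real.rpow_nonneg (by positivity) _
    nlinarith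
  -- the small events (dilute, counted twice, and the nine statistics) add up to at most `δ`
  have hfin := (add_le_add (HD N hND) (add_le_add (HD N hND) ((measure_biUnion_finset_le _ _).trans
    (Finset.sum_le_sum fun p (_ : p ∈ Finset.univ) => HE5 p N (hNE p) p.1 p.2)))).trans
      (DockA.two_add_nine δ hδ.le).le
  -- the null set: the bad set of the flow and the contact sets
  set S : Finset (Fin (N + 1) × Fin (N + 1)) := Finset.univ.filter fun p => p.1 ≠ p.2 with hS
  have hnull : P N ((Φ N).goodᶜ ∪ ⋃ p ∈ S,
      contactSet (Literature.Analysis.FluidPDE.Torus.geometry (Fin 3)) (N + 1) (hsDiameter σ N) p.1 p.2)ᶜᶜ = 0 := by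
    rw [compl_compl, hP_def]
    exact measure_union_null (localGibbsLaw_compl_good' (Φ N))
      ((measure_biUnion_null_iff (Finset.countable_toSet S)).2 fun p hp =>
        ParityBandClosurePressureValue.localGibbsLaw_contactSet hσ a₀ θ₀ u₀ N (Φ N) (Finset.mem_filter.1 hp).2)
  -- the union bound off the null set: on a good dilute datum one of the nine statistics is large
  refine (measure_le_of_imp3 (P N) hnull fun z hzE hzG hzD _ => ?_).trans hfin
  have hz : z ∈ (Φ N).good := by
    by_contra h
    exact hzG (Or.inl h)
  have hnc : ∀ i j : Fin (N + 1), i ≠ j →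
      z ∉ contactSet (Literature.Analysis.FluidPDE.Torus.geometry (Fin 3)) (N + 1) (hsDiameter σ N) i j :=
    fun i j hij h => hzG (Or.inr (mem_iUnion₂.2 ⟨(i, j), Finset.mem_filter.2 ⟨Finset.mem_univ _, hij⟩, h⟩))
  by_contra hzF
  simp only [mem_iUnion, exists_prop, Finset.mem_univ, true_and, not_exists, not_and, mem_setOf_eq,
    not_lt] at hzF hzD
  -- [CeilR]: the block ceiling is an `r`-ceiling, so the cut-off is inert along the orbit
  have hinert : ∀ s ∈ Icc 0 t, ∀ x : T3, 2 * (σ ^ 3 * mollDensity r ((Φ N).flow s z) x) ≤ η₀' := by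
    intro s hs x
    have hσ3 : 0 < σ ^ 3 := pow_pos hσ 3
    have h := Hceil γ C φ hγ hadm r hr hr4 N hℓr (η₀' / 8 / σ ^ 3) (by positivity) ((Φ N).flow s z)
      (fun y => by rw [le_div_iff₀ hσ3]; exact hzD s hs y) x
    have h2 : c * ((N : ℝ) + 1) ^ (-γ) / r ≤ 1 := (div_le_one hr).2 hcℓ
    have h3 : mollDensity r ((Φ N).flow s z) x ≤ η₀' / 8 / σ ^ 3 * 2 :=
      h.trans (mul_le_mul_of_nonneg_left (by linarith) (by positivity))
    rw [div_mul_eq_mul_div, le_div_iff₀ hσ3] at h3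
    nlinarith [h3, hσ3, hη₀']
  have hcore := DockA.core_bound (η' := η / 5) hσ hhalf hr (by linarith) ht hτ hη₀' (min_le_right _ _) hYt hYeq
    Φ hz hnc hA hinert fun k l => hzF (k, l)
  rw [mem_setOf_eq] at hzE
  linarith

end

end Summit.AtomisticToContinuum.HydrodynamicLimit.Theorems.HemisphereAffineSlaving
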